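import Summits.QuantumFields.YangMills.Theorems.UV3PinnedStepOfPackage
import Summits.QuantumFields.YangMills.Theorems.AlphaInputsT3ACPint
import HarnessLib

/-!
# R3 (cell `ym3-torus`, YM₃ on T³ — a ladder RUNG, NOT d = 4, NOT the Clay problem), UV3-node side of `stub_pinnedStep` (R-19936-S) —
# **(S-KNIT): THE `Ecst`-ANCHORED PURE-PIN (41) AT THE UNIT LATTICE (`hPinA` of w8 g11's S-faces) FROM ROW (S-i) (✓`UV3PinnedStepOfPackage`, kernel,
# modulo the package) AND ONE DISPLAYED ROW (S-ii) — the pinned large-field leaf over the RESTRICTED history sum**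

Seat `ym3-torus-px8` g11.  THEOREMS ONLY (0 `def`, 0 `sorry`); `--supports stmt-QuantumFields-19936 --as helper`; count-neutral.  LOCATE
`LOCATE-PINNED41-RESTRICTION-px8g11.md` (19936 evidence #57) §3, knit (S-i) ∧ (S-ii) ∧ (46) ⟹ `hStep″`/`hPinA`.  INPUTS BY NAME: ✓`AlphaInputsT3AC.PkgAt.
resDensity_pinned_le_sum_ae` (row (S-i) at `k = K`), ✓`AlphaInputsT3AC.Of.abs_dataT3_Pint_top_le` ((46) at the top level, w8 g11 ✓p746843), ✓`AlphaInputsT3AC.Of.dataT3_exp_two_Rm_le`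
with `Rm ≥ 0` (`AlphaAdaptersAC.rm_nonnegAC`), ✓`AlphaInputsT3AC.PkgAt.eps1_eq` (`eps1Of j = θBal(K−j)` at the package profile).  DISPLAYED: row (S-ii) — for the
package's data at `(γ, K)`, the lane's masses RESTRICTED to the pinned family «`a ∈ P_j(h)` ∨ `a` meets an earlier enlargement» weighted by `e^{−mainT_K + Zterm_K}` sum, `dV_K`-a.e. (RULING №32: the masses are RN versions), to at most
`e^{CZ}·β_{K−j}^A·e^{−c·p_𝔠(g_{K−j})²}` ([Balaban1985UV3] (67)–(71) pp.273–274 + [9] §3.C with the pinned plaquette's factor KEPT; for CAPPED masses this is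
✓`UV3PinnedLargeFieldResummation.largeField_pinned_of_resummation` + `HistModel.dominated`; for the AC masses it is R-19936-S's organ = the (U)-organ `hlf` of
✓`UV3UnitEnvelopeFaceOfPackageV3` with one factor kept — NOT proved here).

WHAT IS PROVED (ns `…Theorems.UV3PinnedStepKnitOfPackage`):
* §1 ★★★ `AlphaInputsT3AC.Of.pinnedTop_of_pinnedLF` — PER FAMILY, RECORD, SOCKET, COUPLING, DEPTH: (S-ii) for `h.pkgAt` ⟹ `∃ Cu c A, 0 < c ∧ ∀ K j ⟨guards⟩ a, ∀ᵐ V,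
  resDensity F γ K {θBal_𝔠(K−j) ≤ dist1 (Ū^j U)(∂a)} K V ≤ exp(−(h.dataT3 γ hγ hγ1 π).Ecst K K + Cu)·(β_{K−j}^A·exp(−(c·pFun 𝔠.b₀ 𝔠.p₀ (g_{K−j}))²))` (`Cu := CP + CZ + log CRm`).
* §2 ★★★ `hPinA_of_pinnedLF` — w8 g11's `hPinA` letter (`UV3PinnedStepV3FaceOfPackage` 1dfc116c, binder text VERBATIM) from the same-prefixed (S-ii) row, `γ₁` passed through.

HONEST SCOPE.  Bookkeeping (constants pulled through a finite sum); CONDITIONAL on the package and on the displayed row (S-ii); nothing of (S-ii), `stub_pinnedStep` (v2′/v3), `hP`/`hP′`,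
`HistoryTailL` (19936) is proved; nothing continuum ∕ OS ∕ mass-gap ∕ Clay.
References: T. Bałaban, CMP **102** (1985) 255–275 [Balaban1985UV3] ((7) p. 257, (41) p. 266, (46) p. 267, (64) p. 273, (67)–(71) pp. 273–274).
-/

set_option autoImplicit false

noncomputable section

namespace Summit.QuantumFields.YangMills.Theorems.UV3PinnedStepKnitOfPackage

open MeasureTheory
open Literature.MathematicalPhysics.QuantumFieldTheory.Balaban1983to89
open Literature.MathematicalPhysics.QuantumFieldTheory.Balaban1983to89.T3ContinuumYM3Torus
open Literature.MathematicalPhysics.QuantumFieldTheory.Balaban1983to89.T3UnitLawDensityEML (ℰp)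
open Literature.MathematicalPhysics.QuantumFieldTheory.Balaban1983to89.T3UnitScaleTilt (θBal)
open Literature.MathematicalPhysics.QuantumFieldTheory.Balaban1983to89.T3RestrictedUnitDensity (resDensity)
open Literature.MathematicalPhysics.QuantumFieldTheory.Balaban1983to89.T3AlphaInputsAC
open Literature.MathematicalPhysics.QuantumFieldTheory.Balaban1985CMP102
open Literature.MathematicalPhysics.QuantumFieldTheory.Balaban1985CMP102.Setting
open Summit.QuantumFields.Balaban3D.Carriers
open Summit.QuantumFields.Balaban3D.Proofs.Primitives
open Summit.QuantumFields.Balaban3D.Proofs.TowerAC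
open Summit.QuantumFields.Balaban3D.Proofs.StandardAC
open Summit.QuantumFields.Balaban3D.Proofs.Inputs
open Summit.QuantumFields.Balaban3D.Proofs.InputsAC
open Summit.QuantumFields.Balaban3D.Proofs.AlphaAdaptersAC (rm_nonnegAC)

variable {F : T3Family} {𝔠 : AlphaConsts F.L (suGroupModel 2).N}

/-! ## §1 Per family: the anchored pure-pin (41) at the unit lattice from (S-i) and the displayed (S-ii) -/

open Classical in
/-- ★★★ **THE `Ecst`-ANCHORED PURE-PIN (41) AT THE UNIT LATTICE, PER FAMILY, FROM ROW (S-i) AND THE DISPLAYED ROW (S-ii).**  Socket `h : Of F 𝔠`, coupling in the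
window, polymer fields `π`, depth `m`; (S-ii) `hSii`: constants `CZ, c > 0, A` with, at the constrained heights `1 ≤ j`, `j + 2 ≤ K`, `j + ⌊(K−1)∕m⌋ ≤ K`, every level-`j`
plaquette `a` and `dV_K`-ALMOST EVERY unit-lattice field `W` (★★OWNER RULING №32: the masses are Radon–Nikodym versions — R526 hand w6 g7's letter note), the RESTRICTED sum of the lane's masses of the package's data `h.pkgAt γ hγ hγ1 K` over «`a ∈ h′(j)` ∨ `¬ plaqCover a ⊆ Ω_j(h′↾j)`»
weighted by `exp(−mainT_K + Zterm_K)` at most `exp CZ·(β_{K−j}^A·exp(−(c·pFun 𝔠.b₀ 𝔠.p₀ (g_{K−j}))²))`.  THEN `∃ Cu c A, 0 < c ∧` at the same heights∕plaquettes, `dV_K`-a.e.,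
`ρ^{Pin(K,j,a)}_K ≤ exp(−Ecst K K + Cu)·(β_{K−j}^A·exp(−(c·pFun 𝔠.b₀ 𝔠.p₀ (g_{K−j}))²))` with `Pin(K,j,a) := {θBal_𝔠(K−j) ≤ dist1 (Ū^j U)(∂a)}` and `Ecst` the datum
`dataT3`'s (64) constant (`= E_K − E`).  Proof: (S-i) at `k = K` (`θ := θBal = eps1Of j`, ✓`PkgAt.eps1_eq`), (46) `Pint_K ≤ CP` termwise, `e^{Rm_K} ≤ CRm` (`Rm ≥ 0`,
✓`dataT3_exp_two_Rm_le`), then `hSii`; `Cu := CP + CZ + log CRm`. [cite: Balaban1985UV3, (41) p.266 + (46) p.267 + (64) p.273 + (67)-(71) pp.273-274] -/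
theorem _root_.Summit.QuantumFields.YangMills.Theorems.AlphaInputsT3AC.Of.pinnedTop_of_pinnedLF (h : AlphaInputsT3AC.Of F 𝔠)
    (γ : ℝ) (hγ : 0 < γ) (hγ1 : γ ≤ (min 𝔠.gamma0 1) ^ 2) (π : AlphaInputsT3AC.PolymerT3 F) (m : ℕ)
    (hSii : ∃ (CZ c : ℝ) (A : ℕ), 0 < c ∧
      ∀ (K j : ℕ) (hj1 : 1 ≤ j) (hjK : j + 2 ≤ K), j + (K - 1) / m ≤ K → ∀ (a : Plaq (F.P K) j),
        ∀ᵐ W ∂(fieldMeasure (F.P K) K (Matrix.specialUnitaryGroup (Fin 2) ℂ)),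
        ∑ r ∈ Finset.univ.filter (fun r : Hist (F.P K) K =>
            a ∈ r ⟨j, by omega⟩ ∨ ¬ plaqCover a ⊆ Omega 𝔠.lane.carrier.M₁
              (rcolOf (T3Scales F γ hγ (hγ1.trans (sq_min_one_le _ 𝔠.gamma0_pos)) K) 𝔠.lane.carrier) j
              (fun i : Fin j => r (Fin.castLE (by omega) i)) j),
          (inputOfAC 𝔠.lane (h.pkgAt γ hγ hγ1 K).X (h.pkgAt γ hγ hγ1 K).𝔖).W.mass K r W *
            Real.exp (-((h.pkgAt γ hγ hγ1 K).T.mainT K r W) + (h.pkgAt γ hγ hγ1 K).T.Zterm K r) ≤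
        Real.exp CZ * ((F.scheme ℰp γ).β (K - j) ^ A *
          Real.exp (-(c * B10.pFun 𝔠.b₀ 𝔠.p₀ (Real.sqrt (γ * ((F.L : ℝ)⁻¹) ^ (K - j))) ^ 2)))) :
    ∃ (Cu c : ℝ) (A : ℕ), 0 < c ∧
      ∀ (K j : ℕ), 1 ≤ j → j + 2 ≤ K → j + (K - 1) / m ≤ K → ∀ (a : Plaq (F.P K) j),
        ∀ᵐ V ∂(fieldMeasure (F.P K) K (Matrix.specialUnitaryGroup (Fin 2) ℂ)),
          resDensity F γ K
            {U : GaugeField (F.P K) 0 (Matrix.specialUnitaryGroup (Fin 2) ℂ) |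
              θBal F.L γ 𝔠.b₀ 𝔠.p₀ (K - j) ≤ GaugeGroup.dist1 (GaugeField.plaqHol
                (Averaging.iter (fun i' => BlockAveraging.blockAvg (P := F.P K) (j := i') ℰp) j U) a)}
            K V ≤
          Real.exp (-((h.dataT3 γ hγ hγ1 π).Ecst K K) + Cu) *
            ((F.scheme ℰp γ).β (K - j) ^ A *
              Real.exp (-(c * B10.pFun 𝔠.b₀ 𝔠.p₀ (Real.sqrt (γ * ((F.L : ℝ)⁻¹) ^ (K - j))) ^ 2))) := by
  obtain ⟨CZ, c, A, hc, hS⟩ := hSii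
  obtain ⟨CRm, hCRm⟩ := h.dataT3_exp_two_Rm_le γ hγ hγ1 π
  -- the (46) constant at the top level (K-uniform)
  set CP : ℝ := 𝔠.C46 * (𝔠.M₁ : ℝ) ^ 3 * θBal F.L γ 𝔠.b₀ 𝔠.p₀ 1 ^ 2 * (2 * (F.L : ℝ) ^ F.m) ^ 3 with hCP
  have hCRm_pos : 0 < CRm := lt_of_lt_of_le (Real.exp_pos _) (hCRm 0 0 le_rfl)
  refine ⟨CP + CZ + Real.log CRm, c, A, hc, fun K j hj1 hjK hjm a => ?_⟩
  set p := h.pkgAt γ hγ hγ1 K with hp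
  -- the pin threshold is the lane's `eps1Of j`
  have hθ : eps1Of (T3Scales F γ hγ (hγ1.trans (sq_min_one_le _ 𝔠.gamma0_pos)) K) 𝔠.lane.carrier j ≤
      θBal F.L γ 𝔠.b₀ 𝔠.p₀ (K - j) := by
    have e := p.eps1_eq j (by omega)
    exact le_of_eq e
  -- row (S-i) at the unit lattice
  have hSi := p.resDensity_pinned_le_sum_ae j (by omega) a (θBal F.L γ 𝔠.b₀ 𝔠.p₀ (K - j)) hθ K (by omega) le_rfl
  -- `Rm_K ≥ 0` and `e^{Rm_K} ≤ CRm`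
  have hRm0 : 0 ≤ p.T.Rm K := rm_nonnegAC 𝔠.lane p.X p.𝔖 K
  have hRm : Real.exp (p.T.Rm K) ≤ CRm := by
    have h2 := hCRm K K le_rfl
    have hle : Real.exp (p.T.Rm K) ≤ Real.exp (2 * (h.dataT3 γ hγ hγ1 π).Rm K K) := by
      apply Real.exp_le_exp.mpr
      show p.T.Rm K ≤ 2 * p.T.Rm K
      linarith
    exact hle.trans h2
  -- (46) at the top level, termwise
  have hPint : ∀ (r : Hist (F.P K) K) (W : GaugeField (F.P K) K (Matrix.specialUnitaryGroup (Fin 2) ℂ)), p.T.Pint K r W ≤ CP := fun r W => by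
    have h46 := h.abs_dataT3_Pint_top_le γ hγ hγ1 π K r W
    exact (le_abs_self _).trans h46
  have hSKj := hS K j hj1 hjK hjm a
  filter_upwards [hSi, hSKj] with W hW hSW
  refine hW.trans ?_
  -- pull `Pint ≤ CP`, `−Ecst_K`, `Rm_K` out of the restricted sum
  set Sf := Finset.univ.filter (fun r : Hist (F.P K) K =>
      a ∈ r ⟨j, by omega⟩ ∨ ¬ plaqCover a ⊆ Omega 𝔠.lane.carrier.M₁
        (rcolOf (T3Scales F γ hγ (hγ1.trans (sq_min_one_le _ 𝔠.gamma0_pos)) K) 𝔠.lane.carrier) j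
        (fun i : Fin j => r (Fin.castLE (by omega) i)) j) with hSf
  have hterm : ∀ r ∈ Sf, (inputOfAC 𝔠.lane p.X p.𝔖).W.mass K r W *
        Real.exp (-(p.T.mainT K r W) + p.T.Pint K r W - p.T.Ecst K + p.T.Zterm K r + p.T.Rm K) ≤
      Real.exp (CP - p.T.Ecst K + p.T.Rm K) * ((inputOfAC 𝔠.lane p.X p.𝔖).W.mass K r W *
        Real.exp (-(p.T.mainT K r W) + p.T.Zterm K r)) := by
    intro r _
    have hm0 := (inputOfAC 𝔠.lane p.X p.𝔖).W.mass_nonneg K r W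
    have hexp : Real.exp (-(p.T.mainT K r W) + p.T.Pint K r W - p.T.Ecst K + p.T.Zterm K r + p.T.Rm K) ≤
        Real.exp (CP - p.T.Ecst K + p.T.Rm K) * Real.exp (-(p.T.mainT K r W) + p.T.Zterm K r) := by
      rw [← Real.exp_add]
      exact Real.exp_le_exp.mpr (by linarith [hPint r W])
    calc (inputOfAC 𝔠.lane p.X p.𝔖).W.mass K r W *
          Real.exp (-(p.T.mainT K r W) + p.T.Pint K r W - p.T.Ecst K + p.T.Zterm K r + p.T.Rm K)
        ≤ (inputOfAC 𝔠.lane p.X p.𝔖).W.mass K r W *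
          (Real.exp (CP - p.T.Ecst K + p.T.Rm K) * Real.exp (-(p.T.mainT K r W) + p.T.Zterm K r)) :=
          mul_le_mul_of_nonneg_left hexp hm0
      _ = _ := by ring
  have hsum := Finset.sum_le_sum hterm
  rw [← Finset.mul_sum] at hsum
  have hrate : 0 ≤ (F.scheme ℰp γ).β (K - j) ^ A *
      Real.exp (-(c * B10.pFun 𝔠.b₀ 𝔠.p₀ (Real.sqrt (γ * ((F.L : ℝ)⁻¹) ^ (K - j))) ^ 2)) :=
    mul_nonneg (pow_nonneg (F.scheme_β_nonneg ℰp hγ.le (K - j)) A) (Real.exp_nonneg _)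
  -- assemble
  have hEcst : (h.dataT3 γ hγ hγ1 π).Ecst K K = p.T.Ecst K - p.E := rfl
  have hscal : Real.exp (-(p.T.Ecst K - p.E) + (CP + CZ)) * CRm =
      Real.exp (-((h.dataT3 γ hγ hγ1 π).Ecst K K) + (CP + CZ + Real.log CRm)) := by
    rw [hEcst, show -(p.T.Ecst K - p.E) + (CP + CZ + Real.log CRm) = (-(p.T.Ecst K - p.E) + (CP + CZ)) + Real.log CRm by ring,
      Real.exp_add (-(p.T.Ecst K - p.E) + (CP + CZ)) (Real.log CRm), Real.exp_log hCRm_pos]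
  calc Real.exp p.E * ∑ r ∈ Sf, (inputOfAC 𝔠.lane p.X p.𝔖).W.mass K r W *
          Real.exp (-(p.T.mainT K r W) + p.T.Pint K r W - p.T.Ecst K + p.T.Zterm K r + p.T.Rm K)
      ≤ Real.exp p.E * (Real.exp (CP - p.T.Ecst K + p.T.Rm K) * ∑ r ∈ Sf, (inputOfAC 𝔠.lane p.X p.𝔖).W.mass K r W *
          Real.exp (-(p.T.mainT K r W) + p.T.Zterm K r)) := mul_le_mul_of_nonneg_left hsum (Real.exp_nonneg _)
    _ ≤ Real.exp p.E * (Real.exp (CP - p.T.Ecst K + p.T.Rm K) * (Real.exp CZ * ((F.scheme ℰp γ).β (K - j) ^ A *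
          Real.exp (-(c * B10.pFun 𝔠.b₀ 𝔠.p₀ (Real.sqrt (γ * ((F.L : ℝ)⁻¹) ^ (K - j))) ^ 2))))) :=
        mul_le_mul_of_nonneg_left (mul_le_mul_of_nonneg_left (by rw [hSf]; exact hSW) (Real.exp_nonneg _)) (Real.exp_nonneg _)
    _ = (Real.exp (-(p.T.Ecst K - p.E) + (CP + CZ)) * Real.exp (p.T.Rm K)) * ((F.scheme ℰp γ).β (K - j) ^ A *
          Real.exp (-(c * B10.pFun 𝔠.b₀ 𝔠.p₀ (Real.sqrt (γ * ((F.L : ℝ)⁻¹) ^ (K - j))) ^ 2))) := by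
        have : Real.exp p.E * (Real.exp (CP - p.T.Ecst K + p.T.Rm K) * Real.exp CZ) =
            Real.exp (-(p.T.Ecst K - p.E) + (CP + CZ)) * Real.exp (p.T.Rm K) := by
          rw [← Real.exp_add, ← Real.exp_add, ← Real.exp_add]; congr 1; ring
        rw [← this]; ring
    _ ≤ (Real.exp (-(p.T.Ecst K - p.E) + (CP + CZ)) * CRm) * ((F.scheme ℰp γ).β (K - j) ^ A *
          Real.exp (-(c * B10.pFun 𝔠.b₀ 𝔠.p₀ (Real.sqrt (γ * ((F.L : ℝ)⁻¹) ^ (K - j))) ^ 2))) :=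
        mul_le_mul_of_nonneg_right (mul_le_mul_of_nonneg_left hRm (Real.exp_nonneg _)) hrate
    _ = Real.exp (-((h.dataT3 γ hγ hγ1 π).Ecst K K) + (CP + CZ + Real.log CRm)) * ((F.scheme ℰp γ).β (K - j) ^ A *
          Real.exp (-(c * B10.pFun 𝔠.b₀ 𝔠.p₀ (Real.sqrt (γ * ((F.L : ℝ)⁻¹) ^ (K - j))) ^ 2))) := by
        rw [hscal]

/-! ## §2 The `hPinA` letter of the S-faces from the same-prefixed (S-ii) row -/

open Classical in
/-- ★★★ **`hPinA` (w8 g11's S-faces `UV3PinnedStepV3FaceOfPackage` ∕ `…V3`, binder text verbatim) FROM THE (S-ii) ROW WITH THE SAME PREFIX.**  Per block size `L`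
and record `𝔠` with its sockets `hOf`; per depth `m` the (S-ii) row supplies a threshold `γ₁` and, per family∕coupling below it, the restricted-sum bound; §1 family by
family (after `subst`).  The threshold is passed through unchanged. [cite: Balaban1985UV3, (41) p.266 + (46) p.267 + (64) p.273 + (67)-(71) pp.273-274] -/
theorem hPinA_of_pinnedLF (π : ∀ F : T3Family, AlphaInputsT3AC.PolymerT3 F)
    (hSii : ∀ (L : ℕ) (𝔠 : AlphaConsts L (suGroupModel 2).N)
      (hOf : ∀ (F : T3Family) (hF : F.L = L), AlphaInputsT3AC.Of F (hF ▸ 𝔠)),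
        ∀ (m : ℕ), 0 < m →
          ∃ γ₁ : ℝ, 0 < γ₁ ∧ ∀ (F : T3Family) (hF : F.L = L)
            (γ : ℝ) (hγ : 0 < γ) (hγ1' : γ ≤ (min (hF ▸ 𝔠).gamma0 1) ^ 2), γ ≤ γ₁ →
            ∃ (CZ c : ℝ) (A : ℕ), 0 < c ∧
              ∀ (K j : ℕ) (hj1 : 1 ≤ j) (hjK : j + 2 ≤ K), j + (K - 1) / m ≤ K → ∀ (a : Plaq (F.P K) j),
                ∀ᵐ W ∂(fieldMeasure (F.P K) K (Matrix.specialUnitaryGroup (Fin 2) ℂ)),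
                ∑ r ∈ Finset.univ.filter (fun r : Hist (F.P K) K =>
                    a ∈ r ⟨j, by omega⟩ ∨ ¬ plaqCover a ⊆ Omega (hF ▸ 𝔠).lane.carrier.M₁
                      (rcolOf (T3Scales F γ hγ (hγ1'.trans (sq_min_one_le _ (hF ▸ 𝔠).gamma0_pos)) K) (hF ▸ 𝔠).lane.carrier) j
                      (fun i : Fin j => r (Fin.castLE (by omega) i)) j),
                  (inputOfAC (hF ▸ 𝔠).lane ((hOf F hF).pkgAt γ hγ hγ1' K).X ((hOf F hF).pkgAt γ hγ hγ1' K).𝔖).W.mass K r W *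
                    Real.exp (-(((hOf F hF).pkgAt γ hγ hγ1' K).T.mainT K r W) + ((hOf F hF).pkgAt γ hγ hγ1' K).T.Zterm K r) ≤
                Real.exp CZ * ((F.scheme ℰp γ).β (K - j) ^ A *
                  Real.exp (-(c * B10.pFun (hF ▸ 𝔠).b₀ (hF ▸ 𝔠).p₀ (Real.sqrt (γ * ((F.L : ℝ)⁻¹) ^ (K - j))) ^ 2)))) :
    ∀ (L : ℕ) (𝔠 : AlphaConsts L (suGroupModel 2).N)
      (hOf : ∀ (F : T3Family) (hF : F.L = L), AlphaInputsT3AC.Of F (hF ▸ 𝔠)),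
        ∀ (m : ℕ), 0 < m →
          ∃ γ₁ : ℝ, 0 < γ₁ ∧ ∀ (F : T3Family) (hF : F.L = L)
            (γ : ℝ) (hγ : 0 < γ) (hγ1' : γ ≤ (min (hF ▸ 𝔠).gamma0 1) ^ 2), γ ≤ γ₁ →
            ∃ (Cu c : ℝ) (A : ℕ), 0 < c ∧
              ∀ (K j : ℕ), 1 ≤ j → j + 2 ≤ K → j + (K - 1) / m ≤ K → ∀ (a : Plaq (F.P K) j),
                ∀ᵐ V ∂(fieldMeasure (F.P K) K (Matrix.specialUnitaryGroup (Fin 2) ℂ)),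
                  resDensity F γ K
                    {U : GaugeField (F.P K) 0 (Matrix.specialUnitaryGroup (Fin 2) ℂ) |
                      θBal F.L γ (hF ▸ 𝔠).b₀ (hF ▸ 𝔠).p₀ (K - j) ≤ GaugeGroup.dist1 (GaugeField.plaqHol
                        (Averaging.iter (fun i' => BlockAveraging.blockAvg (P := F.P K) (j := i') ℰp) j U) a)}
                    K V ≤
                  Real.exp (-(((hOf F hF).dataT3 γ hγ hγ1' (π F)).Ecst K K) + Cu) *
                    ((F.scheme ℰp γ).β (K - j) ^ A *
                      Real.exp (-(c * B10.pFun (hF ▸ 𝔠).b₀ (hF ▸ 𝔠).p₀ (Real.sqrt (γ * ((F.L : ℝ)⁻¹) ^ (K - j))) ^ 2))) := by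
  intro L 𝔠 hOf m hm
  obtain ⟨γ₁, hγ₁, HF⟩ := hSii L 𝔠 hOf m hm
  refine ⟨γ₁, hγ₁, fun F hF γ hγ hγ1' hγle => ?_⟩
  subst hF
  exact (hOf F rfl).pinnedTop_of_pinnedLF γ hγ hγ1' (π F) m (HF F rfl γ hγ hγ1' hγle)

end Summit.QuantumFields.YangMills.Theorems.UV3PinnedStepKnitOfPackage

end
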